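import Literature.NumberTheory.Automorphic.TwistedAsaiPole
import HarnessLib

/-!
# Meromorphic continuation of the twisted partial Asai `L`-functions of a cuspidal representation
# of `GL₂(𝔸_E)` near `Re s ≥ 1` (Flicker 1988; named fact)

Topic `NumberTheory/Automorphic`; namespace `Literature.NumberTheory.Automorphic`. One named fact
(`def … : Prop`, D-0014), no proof, no new predicate: the analytic input that turns the
continuation-currency rendering of "`L^S(s, Π, As^η ⊗ χ)` has a pole at `s = 1`" into a usable
hypothesis for the rank `N = 2` (needed by the crux `ParityBlindBianchi.QuadraticDescentGL2`, line
`Sketch`, stub `stub_twistedAsaiPoleCont`; requested by the stub worker's `hHol` in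
`Summits/Langlands/Langlands/Theorems/ParityBlindBianchiQuadraticDescentGL2TwistedAsaiPoleCont.lean`).

**Source.** Y. Flicker, *Twisted tensors and Euler products*, Bull. SMF 116 (1988), Theorem
(p. 297): for a quadratic extension `E/F` of global fields and a cuspidal `GL_n(𝔸_E)`-module `π`
whose central character is trivial on `𝔸_F^×`, the partial twisted tensor Euler product
`L(s, r(π), V) = ∏_{v ∉ V} det[1 - q_v^{-s} r(t_v)]⁻¹` (`V` a finite set of places of `F` containing
the archimedean places, the places ramified in `E` and those below a ramified place of `π`)
converges absolutely in some right half-plane and continues to a meromorphic function on `ℂ` whose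
only possible poles are simple, at `s = 0` and `s = 1` — the Rankin–Selberg integral of a cusp form
of `π` restricted to `GL_n(𝔸_F)` against the mirabolic Eisenstein series `E(h, Φ, s)`; the
non-vanishing of the archimedean local integrals needed to pass from the global integral to the
partial product is Flicker–Zinoviev, Proc. Japan Acad. 71 (1995). The twist by a character `χ` of
`𝔸_F^× / F^×` is Flicker's reduction of p. 296 ("we can replace `π` by its product with a character"):
`L(s, r(π ⊗ χ̃), V) = L(s, r(π) ⊗ χ̃|_{𝔸_F^×}, V)` for any Hecke character `χ̃` of `E` extending `χ`
(extension of continuous characters from the closed subgroup `C_F ≤ C_E`: Hewitt–Ross (24.12)); on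
Satake data this is the tree's `partialAsaiL_twist_eq_partialAsaiLTwist` (`TwistedAsaiPole`).

**The rendering** (rank `2`, the case the tree consumes). For `E/F` quadratic with involution
`c ≠ 1`, a cuspidal Borel–Jacquet datum `P` on `GL₂(𝔸_E)`, a Hecke character `χ` of `F`, and an
Asai datum `(S, A)` of `P` (`IsAsaiDatum`: `S` finite, `A w = t_{P,w}` above `v ∉ S`, `c`-fixed
places above `v ∉ S` inert) with `χ` unramified off `S` and **`e₂(A w) · χ(ϖ_v)^{f(w|v)} = 1` above
every `v ∉ S`** (i.e. `ω_P = χ⁻¹ ∘ N_{E/F}`, by the Satake shadow of the central character and the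
rigidity of Hecke characters; then `P ⊗ χ̃` has central character `ω_P χ̃²` trivial on `𝔸_F^×`, which
is Flicker's hypothesis, and `L^S(s, P ⊗ χ̃, As^θ) = L^S(s, P, As^θ ⊗ χ)`; the sign `θ = -1` is the
character `χ ω_{E/F}`, `As⁻ = As⁺ ⊗ ω_{E/F}`): there is `σ₀ ≥ 1` beyond which both twisted partial Asai
Euler products `L^S(s, P, As^θ ⊗ χ) = partialAsaiLTwist S c A (χ.valueAtUniformizer) θ s` converge
(`Multipliable`), and `δ > 0` such that for each sign `θ` the function `(s - 1) L^S(s, P, As^θ ⊗ χ)`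
extends from `{σ₀ < Re s}` to a function holomorphic on `{1 < Re s} ∪ B(1, δ)` — i.e. the continued
`L^S(s, P, As^θ ⊗ χ)` is holomorphic on `Re s > 1` and has at most a simple pole at `s = 1`. Only this
neighbourhood of `{Re s ≥ 1} ∩ ({Re s > 1} ∪ {1})` is asserted (weaker than the printed "meromorphic
on `ℂ`, poles at most at `0, 1`"), which is all the pole dichotomy at `s = 1` consumes.

**Why the central-character clause is part of the statement.** Without it the assertion is false
for Borel–Jacquet data, which carry a free twist `|det|^{s₁}`: for `P = P₀ ⊗ |det|_E^{-b/2}`, `b > 0`,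
with `P₀` unitary, `Gal(E/F)`-stable, and `L^S(s, P₀, As⁺)` having its pole at `s = 1`, the Satake
parameters are multiplied by `q_w^{b/2}`, so `As(P) = As(P₀) ⊗ |·|_F^{-b}` and
`L^S(s, P, As⁺) = L^S(s - b, P₀, As⁺)` has a pole at `s = 1 + b ∈ {1 < Re s}` (take `χ = 1`).

Stated for `N = 2` only.
-- TODO(general form): Flicker's theorem for cuspidal `π` on `GL_n(𝔸_E)` with `ω_π χ̃ⁿ` trivial on
-- `𝔸_F^×`, meromorphic on `ℂ` with functional equation and poles at most at `s = 0, 1`.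

## References

* Y. Z. Flicker, *Twisted tensors and Euler products*, Bull. Soc. Math. France 116 (1988), 295–313:
  Theorem p. 297; p. 296 (twists); §§2–4 (integral representation, local integrals). [Flicker1988]
* Y. Z. Flicker, D. Zinoviev, *On poles of twisted tensor `L`-functions*, Proc. Japan Acad. Ser. A 71
  (1995), 114–116 (archimedean non-vanishing). [FlickerZinoviev1995]
* E. Hewitt, K. A. Ross, *Abstract Harmonic Analysis I* (1979), (24.12) (extension of characters
  from closed subgroups). [HewittRoss1979]
-/

noncomputable section

open scoped Classical
open Filter Polynomial NumberField IsDedekindDomain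

namespace Literature.NumberTheory.Automorphic

open Literature.NumberTheory.GaloisRepresentations (HeckeCharacter)

/-- **Flicker 1988 (Theorem p. 297, with the twist of p. 296), rank `2`, near `Re s ≥ 1`: the twisted
partial Asai `L`-functions of a cuspidal `P` on `GL₂(𝔸_E)` with `ω_P = χ⁻¹ ∘ N_{E/F}` continue, after
multiplication by `(s - 1)`, holomorphically to `{1 < Re s} ∪ B(1, δ)`.** For `E/F` quadratic with
involution `c ≠ 1`, `P : CuspidalAutomorphicRepData 2 E hE`, `χ : HeckeCharacter F`, and every Asai
datum `(S, A)` of `P` with `χ.ramifiedPlaces ⊆ S` and `e₂(A w) · χ(ϖ_v)^{f(w|v)} = 1` above every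
`v ∉ S`: there is `σ₀ ≥ 1` such that for both signs `θ` the Euler product
`L^S(s, P, As^θ ⊗ χ) = ∏_{v ∉ S} P^θ_v(χ(ϖ_v) q_v^{-s})⁻¹` is `Multipliable` on `{σ₀ < Re s}`, and
`δ > 0` such that for each `θ` some `G : ℂ → ℂ`, holomorphic on `{1 < Re s} ∪ B(1, δ)`, agrees with
`(s - 1) · partialAsaiLTwist S c A (χ.valueAtUniformizer) θ s` on `{σ₀ < Re s}` (so the continued
`L^S(s, P, As^θ ⊗ χ)` is holomorphic on `Re s > 1` with at most a simple pole at `s = 1`). In print: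
the partial twisted tensor `L`-function of the cuspidal `P ⊗ χ̃` (`χ̃` a Hecke character of `E`
extending `χ`, Hewitt–Ross (24.12); its central character `ω_P χ̃²` is trivial on `𝔸_F^×`) is
meromorphic on `ℂ` with at most simple poles at `s = 0, 1` (Flicker 1988, Theorem p. 297; archimedean
local non-vanishing: Flicker–Zinoviev 1995), and equals `L^S(s, P, As^θ ⊗ χ)`
(`partialAsaiL_twist_eq_partialAsaiLTwist`; `θ = -1` via `χ ω_{E/F}`). Named fact (D-0014), special
case `N = 2` of Flicker's `GL_n` theorem. [cite: Flicker1988, Theorem p. 297 and p. 296]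
[cite: FlickerZinoviev1995, Theorem] [cite: HewittRoss1979, (24.12)] -/
def Flicker1988_twistedAsaiL_continuation_GL2 : Prop :=
  ∀ (F E : Type) [Field F] [NumberField F] [Field E] [NumberField E] [Algebra F E] (c : E ≃ₐ[F] E),
    Module.finrank F E = 2 → c ≠ 1 →
    ∀ (hE : isCompact_glFiniteIntegralLevel 2 E) (P : CuspidalAutomorphicRepData 2 E hE)
      (χ : HeckeCharacter F) (S : Set (HeightOneSpectrum (𝓞 F))) (A : SatakeFamily E),
      P.1.IsAsaiDatum c S A → χ.ramifiedPlaces ⊆ S →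
      (∀ w : HeightOneSpectrum (𝓞 E), w.under (𝓞 F) ∉ S →
        (A w).prod * χ.valueAtUniformizer (w.under (𝓞 F)) ^ w.asIdeal.inertiaDeg (𝓞 F) = 1) →
      ∃ σ₀ : ℝ, 1 ≤ σ₀ ∧
        (∀ (θ : ℤˣ) (s : ℂ), σ₀ < s.re →
          Multipliable fun v : {v : HeightOneSpectrum (𝓞 F) // v ∉ S} =>
            ((asaiLocalPolynomial c A θ (placeAbove E v.1)).eval
              (χ.valueAtUniformizer v.1 * (v.1.residueCard : ℂ) ^ (-s)))⁻¹) ∧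
        ∃ δ : ℝ, 0 < δ ∧ ∀ θ : ℤˣ, ∃ G : ℂ → ℂ,
          DifferentiableOn ℂ G ({s : ℂ | 1 < s.re} ∪ Metric.ball (1 : ℂ) δ) ∧
          ∀ s : ℂ, σ₀ < s.re →
            G s = (s - 1) * partialAsaiLTwist S c A (fun v => χ.valueAtUniformizer v) θ s

/-- Unfolding lemma for `Flicker1988_twistedAsaiL_continuation_GL2` (by `Iff.rfl`), recording the
shape consumers destructure: `σ₀`, far-right multipliability for both signs, `δ`, and for each sign
a continuation `G` of `(s - 1) L^S(s, P, As^θ ⊗ χ)` to `{1 < Re s} ∪ B(1, δ)`. [folklore] -/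
theorem flicker1988_twistedAsaiL_continuation_GL2_iff :
    Flicker1988_twistedAsaiL_continuation_GL2 ↔
      ∀ (F E : Type) [Field F] [NumberField F] [Field E] [NumberField E] [Algebra F E]
        (c : E ≃ₐ[F] E), Module.finrank F E = 2 → c ≠ 1 →
        ∀ (hE : isCompact_glFiniteIntegralLevel 2 E) (P : CuspidalAutomorphicRepData 2 E hE)
          (χ : HeckeCharacter F) (S : Set (HeightOneSpectrum (𝓞 F))) (A : SatakeFamily E),
          P.1.IsAsaiDatum c S A → χ.ramifiedPlaces ⊆ S →
          (∀ w : HeightOneSpectrum (𝓞 E), w.under (𝓞 F) ∉ S →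
            (A w).prod * χ.valueAtUniformizer (w.under (𝓞 F)) ^ w.asIdeal.inertiaDeg (𝓞 F) = 1) →
          ∃ σ₀ : ℝ, 1 ≤ σ₀ ∧
            (∀ (θ : ℤˣ) (s : ℂ), σ₀ < s.re →
              Multipliable fun v : {v : HeightOneSpectrum (𝓞 F) // v ∉ S} =>
                ((asaiLocalPolynomial c A θ (placeAbove E v.1)).eval
                  (χ.valueAtUniformizer v.1 * (v.1.residueCard : ℂ) ^ (-s)))⁻¹) ∧
            ∃ δ : ℝ, 0 < δ ∧ ∀ θ : ℤˣ, ∃ G : ℂ → ℂ,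
              DifferentiableOn ℂ G ({s : ℂ | 1 < s.re} ∪ Metric.ball (1 : ℂ) δ) ∧
              ∀ s : ℂ, σ₀ < s.re →
                G s = (s - 1) * partialAsaiLTwist S c A (fun v => χ.valueAtUniformizer v) θ s :=
  Iff.rfl

end Literature.NumberTheory.Automorphic

end
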